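import Literature.NumberTheory.DiophantineGeometry.FibreConductorKappa
import HarnessLib

/-!
# Junction: the per-place dichotomy (W5 (C)) + the meeting dictionary ⇒ the conductor slope

Glue for the abc-iut cell's route item GenEllTwo (ledger `stmt-ABC-19679`; [GenEll] = S. Mochizuki,
*Arithmetic elliptic curves in general position*, Math. J. Okayama Univ. **52** (2010), Thm. 2.1, proof
pp. 12–13; work package W5, piece W5d).  The W5 good-place lemma
(`GenEll.De.ord_placewise(_of_gap)`, abc-iut-w5-d045, `GenEllDeGoodPrimesOrd.lean`) delivers at every
good place `w` a DICHOTOMY PAIR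
`((∃ b ∈ B, 0 < ord_w(t − b)) → 1 + ord⁺_w N ≤ Σ_b ord⁺_w(t − b)) ∧ (¬(…) → ord⁺_w N ≤ Σ_b ord⁺_w(t − b))`,
and the meeting dictionary (`FibreConductor.exists_root_ord_sub_pos_of_meets`, `meets_of_under`)
delivers `∃ b ∈ B, 0 < ord_w(t − b)` at every good place of the set `W` whose conductor is to be bounded
(the primes over the conductor support of `z = β(t)`).  This file records, once, that these two shapes
are exactly the `hmeet`/`hoff` hypotheses of `FibreConductor.inv_finrank_mul_sum_logNorm_le_slope` —
no `iff`-description of `W` is needed (off `W` the dichotomy gives the weaker inequality in both cases) —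
and states the resulting slope bound with the dichotomy and the meeting property as hypotheses
(`inv_finrank_mul_sum_logNorm_le_slope_of_dichotomy`).  No definitions; classical.
[cite: MochizukiGenEll2010, Thm 2.1 proof pp.12-13]
-/

noncomputable section

open NumberField IsDedekindDomain Height Real Finset
open Literature.IUT.LogVolume

namespace Literature.NumberTheory.DiophantineGeometry.FibreConductor

variable {L : Type*} [Field L] [NumberField L]

/-- From the per-place dichotomy pair off `Sbad` and the meeting property on `W ∖ Sbad`: the
`hmeet`/`hoff` hypotheses of the slope theorem. [cite: MochizukiGenEll2010, Thm 2.1 proof pp.12-13] -/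
theorem hmeet_hoff_of_dichotomy (t N : L) (B : Finset L) (W Sbad : Finset (HeightOneSpectrum (𝓞 L)))
    (hplace : ∀ w : HeightOneSpectrum (𝓞 L), w ∉ Sbad →
      ((∃ b ∈ B, 0 < ord L w (t - b)) → 1 + (ord L w N).toNat ≤ ∑ b ∈ B, (ord L w (t - b)).toNat) ∧
      ((¬ ∃ b ∈ B, 0 < ord L w (t - b)) → (ord L w N).toNat ≤ ∑ b ∈ B, (ord L w (t - b)).toNat))
    (hW : ∀ w ∈ W, w ∉ Sbad → ∃ b ∈ B, 0 < ord L w (t - b)) :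
    (∀ w ∈ W, w ∉ Sbad → 1 + (ord L w N).toNat ≤ ∑ b ∈ B, (ord L w (t - b)).toNat) ∧
      (∀ w, w ∉ W → w ∉ Sbad → (ord L w N).toNat ≤ ∑ b ∈ B, (ord L w (t - b)).toNat) := by
  refine ⟨fun w hw hb => (hplace w hb).1 (hW w hw hb), fun w _ hb => ?_⟩
  by_cases h : ∃ b ∈ B, 0 < ord L w (t - b)
  · have := (hplace w hb).1 h; omega
  · exact (hplace w hb).2 h

/-- **The conductor slope from the dichotomy and the meeting property** (`hκ` shape): all hypotheses
as in `inv_finrank_mul_sum_logNorm_le_slope` except that `hmeet`/`hoff` are replaced by the dichotomy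
pair off `Sbad` (W5 (C), `De.ord_placewise`) and the meeting property of `W ∖ Sbad` (meeting dictionary).
[cite: MochizukiGenEll2010, Thm 2.1 proof pp.12-13] -/
theorem inv_finrank_mul_sum_logNorm_le_slope_of_dichotomy (k : ℕ) (x t N : L) (B : Finset L)
    (W Sbad : Finset (HeightOneSpectrum (𝓞 L))) {C₁ C₂ C₃ C₄ C₅ C₆ : ℝ}
    (hplace : ∀ w : HeightOneSpectrum (𝓞 L), w ∉ Sbad →
      ((∃ b ∈ B, 0 < ord L w (t - b)) → 1 + (ord L w N).toNat ≤ ∑ b ∈ B, (ord L w (t - b)).toNat) ∧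
      ((¬ ∃ b ∈ B, 0 < ord L w (t - b)) → (ord L w N).toNat ≤ ∑ b ∈ B, (ord L w (t - b)).toNat))
    (hW : ∀ w ∈ W, w ∉ Sbad → ∃ b ∈ B, 0 < ord L w (t - b))
    (hbad₁ : ∑ w ∈ Sbad, ((ord L w N).toNat : ℝ) * logNorm L w ≤ Module.finrank ℚ L * C₁)
    (hbad₂ : ∑ w ∈ Sbad, logNorm L w ≤ Module.finrank ℚ L * C₂)
    (harch : ∀ v : InfinitePlace L, log⁺ (v N⁻¹) ≤ C₃)
    (ht : (2 * k + 1 : ℝ) * logHeight₁ t ≤ (2 * k + 4 : ℝ) * logHeight₁ x + Module.finrank ℚ L * C₄)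
    (hN : (6 * k + 6 : ℝ) * logHeight₁ x ≤ (2 * k + 1 : ℝ) * logHeight₁ N + Module.finrank ℚ L * C₅)
    (hB : ∀ b ∈ B, logHeight₁ b ≤ Module.finrank ℚ L * C₆) :
    (Module.finrank ℚ L : ℝ)⁻¹ * ∑ w ∈ W, logNorm L w ≤
      ((B.card * (2 * k + 4 : ℝ) - (6 * k + 6)) / (2 * k + 1)) *
          ((Module.finrank ℚ L : ℝ)⁻¹ * logHeight₁ x) +
        ((B.card * C₄ + C₅) / (2 * k + 1) + B.card * (C₆ + Real.log 2) + C₁ + C₂ + C₃) := by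
  obtain ⟨hmeet, hoff⟩ := hmeet_hoff_of_dichotomy t N B W Sbad hplace hW
  exact inv_finrank_mul_sum_logNorm_le_slope k x t N B W Sbad hmeet hoff hbad₁ hbad₂ harch ht hN hB

end Literature.NumberTheory.DiophantineGeometry.FibreConductor
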